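import Literature.Computability.AlgebraicComplexity.AlperBogartVelascoBoxThree
import HarnessLib

/-!
# Alper–Bogart–Velasco, Cor. 1.4: linear spaces of `4 × 4` matrices with vanishing `3 × 3` subpermanents

Topic `Literature/Computability/AlgebraicComplexity`; fifth file of the proof of the named fact
`alperBogartVelasco2017_cor_1_4` (`AlperBogartVelasco.lean`).  J. Alper, T. Bogart, M. Velasco,
*A lower bound for the determinantal complexity of a hypersurface*, Found. Comput. Math. 17
(2017), deduce `dc(perm_4) ≥ 9` from their Thm. 1.2 and "`codim Sing(perm_4) = 8` … readily
computed" (arXiv:1505.02205, p. 3; no proof is printed).  As for `perm_3`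
(`AlperBogartVelascoBoxThree.lean`), the proof of Thm. 1.2 only meets the singular locus through
a LINEAR subspace of codimension `≤ m - 1` on which `perm_4` and its sixteen partial derivatives
(the `3 × 3` subpermanents) vanish, and we prove directly:

* `finrank_le_eight_of_subperm_three_vanish`: a linear subspace `W` of `4 × 4` matrices over a
  field on which all sixteen `3 × 3` subpermanents vanish has `dim W ≤ 8` (`= 16 - 8`; attained
  by the matrices with two zero rows).

Proof (no hypothesis on the field).  Filter `W` by rows as in the `3 × 3` case:
`dim W = Σ_{p<4} dim Y_p` with `Y_p = row_p {x ∈ W : rows > p vanish}`.  Polarising the cubics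
`per (rows p<q<r, columns ≠ c)` (vanishing on `W`) gives the vanishing of the trilinear forms
`T_c(u, v, w)` (`= per` of the rows `u, v, w` on the columns `≠ c`) on `Y_p × Y_q × Y_r` for
distinct `p, q, r`.  KEY STEP: if `w_{c₀} ≠ 0`, `dim Y ≥ 3` and `T_c(Y, Y', w) = 0` for all `c`,
then `dim Y' ≤ 1`: for `j ≠ c₀` pick `y ∈ Y ∖ 0` with `y_{c₀} = y_j = 0`; the two `T_c` omitting one
of the remaining columns reduce to `y_k · (v_{c₀} w_j + v_j w_{c₀})`, so this pairing vanishes on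
`Y'`, and `v ↦ v_{c₀}` is injective on `Y'` (`finrank_le_one_of_pairings`).  COUNT: if
`Σ dim Y_p ≥ 9` then some `dim Y_p ≥ 3` and some other `dim Y_r ≥ 1`, whence the two remaining
`dim Y_q ≤ 1`, and either one of them is `≥ 1` (then also `dim Y_r ≤ 1`, total `≤ 7`) or both
vanish (total `≤ 8`) — a contradiction (`sum_le_eight_of_triples`).

## References

* J. Alper, T. Bogart, M. Velasco, Found. Comput. Math. 17 (2017) 829–836,
  doi:10.1007/s10208-015-9300-x, arXiv:1505.02205 — Cor. 1.4 and proof of Thm. 1.2.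
-/

noncomputable section

open Module Finset

namespace Literature.Computability.AlgebraicComplexity

namespace AlperBogartVelasco

variable {K : Type*} [Field K]

/-- The arithmetic of the final count: four numbers `≤ 4` such that, for all distinct `p, q, r`,
`n r ≥ 1` and `n p ≥ 3` force `n q ≤ 1`, sum to at most `8`. [folklore] -/
theorem sum_le_eight_of_triples (n : Fin 4 → ℕ) (hle : ∀ i, n i ≤ 4)
    (hPL : ∀ p q r, p ≠ q → p ≠ r → q ≠ r → 1 ≤ n r → 3 ≤ n p → n q ≤ 1) : ∑ i, n i ≤ 8 := by
  by_contra H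
  push Not at H
  obtain ⟨p, hp⟩ : ∃ p, 3 ≤ n p := by
    by_contra h
    push Not at h
    have h2 : ∑ i, n i ≤ ∑ _i : Fin 4, 2 := Finset.sum_le_sum fun i _ => Nat.le_of_lt_succ (h i)
    simp at h2
    omega
  have hsplit : ∑ i, n i = n p + ∑ i ∈ univ.erase p, n i :=
    (Finset.add_sum_erase _ _ (mem_univ p)).symm
  obtain ⟨r, hr, hr1⟩ : ∃ r ∈ univ.erase p, 1 ≤ n r := by
    by_contra h
    push Not at h
    have h0 : ∑ i ∈ univ.erase p, n i = 0 :=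
      Finset.sum_eq_zero fun i hi => by have := h i hi; omega
    have := hle p
    omega
  have hrp : r ≠ p := (mem_erase.1 hr).1
  have hsplit2 : ∑ i ∈ univ.erase p, n i = n r + ∑ i ∈ (univ.erase p).erase r, n i :=
    (Finset.add_sum_erase _ _ hr).symm
  have hmem : ∀ i ∈ (univ.erase p).erase r, i ≠ r ∧ i ≠ p := fun i hi =>
    ⟨(mem_erase.1 hi).1, (mem_erase.1 (mem_erase.1 hi).2).1⟩
  have hrest1 : ∀ i ∈ (univ.erase p).erase r, n i ≤ 1 := fun i hi =>
    hPL p i r (Ne.symm (hmem i hi).2) hrp.symm (hmem i hi).1 hr1 hp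
  have hcard : ((univ.erase p).erase r).card = 2 := by
    rw [card_erase_of_mem hr, card_erase_of_mem (mem_univ p), card_univ, Fintype.card_fin]
  have hp4 := hle p
  by_cases hq : ∃ q ∈ (univ.erase p).erase r, 1 ≤ n q
  · obtain ⟨q, hq, hq1⟩ := hq
    have hr_le : n r ≤ 1 :=
      hPL p r q hrp.symm (Ne.symm (hmem q hq).2) (Ne.symm (hmem q hq).1) hq1 hp
    have hsum_rest : ∑ i ∈ (univ.erase p).erase r, n i ≤ 2 := by
      have := Finset.sum_le_card_nsmul _ _ 1 hrest1
      rwa [hcard, smul_eq_mul] at this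
    omega
  · push Not at hq
    have h0 : ∑ i ∈ (univ.erase p).erase r, n i = 0 :=
      Finset.sum_eq_zero fun i hi => by have := hq i hi; omega
    have := hle r
    omega

/-- **Linear spaces of `4 × 4` matrices with vanishing `3 × 3` subpermanents have dimension
`≤ 8`** — the elementary replacement, restricted to linear spaces, of
"`codim Sing(perm_4) = 8`" in ABV's deduction of Cor. 1.4 from Thm. 1.2.  The hypothesis lists the
sixteen `3 × 3` subpermanents as the permanents of the submatrices deleting row `r` and column
`c`. [cite: AlperBogartVelasco2017, Cor. 1.4] -/
theorem finrank_le_eight_of_subperm_three_vanish (W : Submodule K (Fin 4 × Fin 4 → K))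
    (hW : ∀ x ∈ W, ∀ r c : Fin 4,
      ((Matrix.of fun i j => x (i, j)).submatrix r.succAbove c.succAbove).permanent = 0) :
    finrank K W ≤ 8 := by
  have hcases : ∀ i : Fin 4, i = 0 ∨ i = 1 ∨ i = 2 ∨ i = 3 := by decide
  -- `succAbove` on `Fin 4`
  have e00 : (0 : Fin 4).succAbove 0 = 1 := by decide
  have e01 : (0 : Fin 4).succAbove 1 = 2 := by decide
  have e02 : (0 : Fin 4).succAbove 2 = 3 := by decide
  have e10 : (1 : Fin 4).succAbove 0 = 0 := by decide
  have e11 : (1 : Fin 4).succAbove 1 = 2 := by decide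
  have e12 : (1 : Fin 4).succAbove 2 = 3 := by decide
  have e20 : (2 : Fin 4).succAbove 0 = 0 := by decide
  have e21 : (2 : Fin 4).succAbove 1 = 1 := by decide
  have e22 : (2 : Fin 4).succAbove 2 = 3 := by decide
  have e30 : (3 : Fin 4).succAbove 0 = 0 := by decide
  have e31 : (3 : Fin 4).succAbove 1 = 1 := by decide
  have e32 : (3 : Fin 4).succAbove 2 = 2 := by decide
  -- the trilinear forms: `T c u v w = per` of the rows `u, v, w` on the columns `≠ c`
  let T : Fin 4 → (Fin 4 → K) → (Fin 4 → K) → (Fin 4 → K) → K := fun c u v w =>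
    u (c.succAbove 0) * (v (c.succAbove 1) * w (c.succAbove 2) + v (c.succAbove 2) * w (c.succAbove 1)) +
    u (c.succAbove 1) * (v (c.succAbove 0) * w (c.succAbove 2) + v (c.succAbove 2) * w (c.succAbove 0)) +
    u (c.succAbove 2) * (v (c.succAbove 0) * w (c.succAbove 1) + v (c.succAbove 1) * w (c.succAbove 0))
  -- its symmetries, as implications
  have hI2 : ∀ c u v w, T c u w v = 0 → T c u v w = 0 := fun c u v w h => by
    simp only [T] at h ⊢; linear_combination h
  have hI3 : ∀ c u v w, T c v u w = 0 → T c u v w = 0 := fun c u v w h => by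
    simp only [T] at h ⊢; linear_combination h
  have hI4 : ∀ c u v w, T c w u v = 0 → T c u v w = 0 := fun c u v w h => by
    simp only [T] at h ⊢; linear_combination h
  have hI5 : ∀ c u v w, T c v w u = 0 → T c u v w = 0 := fun c u v w h => by
    simp only [T] at h ⊢; linear_combination h
  have hI6 : ∀ c u v w, T c w v u = 0 → T c u v w = 0 := fun c u v w h => by
    simp only [T] at h ⊢; linear_combination h
  -- rows as linear maps
  let ρ : Fin 4 → (Fin 4 × Fin 4 → K) →ₗ[K] (Fin 4 → K) :=
    fun r => LinearMap.funLeft K K fun j => (r, j)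
  have hρ : ∀ r x j, ρ r x j = x (r, j) := fun _ _ _ => rfl
  -- the cubics vanishing on `W`, in terms of `T`
  have hF : ∀ y ∈ W, ∀ s c : Fin 4,
      T c (ρ (s.succAbove 0) y) (ρ (s.succAbove 1) y) (ρ (s.succAbove 2) y) = 0 := by
    intro y hy s c
    have h := hW y hy s c
    rw [Matrix.permanent_fin_three_row] at h
    simp only [Matrix.submatrix_apply, Matrix.of_apply] at h
    simp only [T, hρ]
    linear_combination h
  -- the flag `V₀ ≤ V₁ ≤ V₂ ≤ W`
  let V₂ : Submodule K (Fin 4 × Fin 4 → K) := W ⊓ LinearMap.ker (ρ 3)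
  let V₁ : Submodule K (Fin 4 × Fin 4 → K) := V₂ ⊓ LinearMap.ker (ρ 2)
  let V₀ : Submodule K (Fin 4 × Fin 4 → K) := V₁ ⊓ LinearMap.ker (ρ 1)
  let Y : Fin 4 → Submodule K (Fin 4 → K) :=
    ![V₀.map (ρ 0), V₁.map (ρ 1), V₂.map (ρ 2), W.map (ρ 3)]
  have hY0 : Y 0 = V₀.map (ρ 0) := rfl
  have hY1 : Y 1 = V₁.map (ρ 1) := rfl
  have hY2 : Y 2 = V₂.map (ρ 2) := rfl
  have hY3 : Y 3 = W.map (ρ 3) := rfl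
  have memV₂ : ∀ x ∈ V₂, x ∈ W ∧ ∀ j, x (3, j) = 0 := fun x hx => by
    simp only [V₂, Submodule.mem_inf, LinearMap.mem_ker] at hx
    exact ⟨hx.1, fun j => congr_fun hx.2 j⟩
  have memV₁ : ∀ x ∈ V₁, x ∈ W ∧ (∀ j, x (2, j) = 0) ∧ ∀ j, x (3, j) = 0 := fun x hx => by
    simp only [V₁, V₂, Submodule.mem_inf, LinearMap.mem_ker] at hx
    exact ⟨hx.1.1, fun j => congr_fun hx.2 j, fun j => congr_fun hx.1.2 j⟩
  have memV₀ : ∀ x ∈ V₀, x ∈ W ∧ (∀ j, x (1, j) = 0) ∧ (∀ j, x (2, j) = 0) ∧ ∀ j, x (3, j) = 0 :=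
    fun x hx => by
    simp only [V₀, V₁, V₂, Submodule.mem_inf, LinearMap.mem_ker] at hx
    exact ⟨hx.1.1.1, fun j => congr_fun hx.2 j, fun j => congr_fun hx.1.2 j,
      fun j => congr_fun hx.1.1.2 j⟩
  -- dimension count along the flag
  have hdim : finrank K W = ∑ i, finrank K (Y i) := by
    have hbot : (V₀ ⊓ LinearMap.ker (ρ 0) : Submodule K _) = ⊥ := by
      rw [eq_bot_iff]
      intro x hx
      rw [Submodule.mem_inf, LinearMap.mem_ker] at hx
      obtain ⟨-, h1, h2, h3⟩ := memV₀ x hx.1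
      have h0 : ∀ j, x (0, j) = 0 := fun j => congr_fun hx.2 j
      rw [Submodule.mem_bot]
      funext ⟨i, j⟩
      rcases hcases i with rfl | rfl | rfl | rfl
      · exact h0 j
      · exact h1 j
      · exact h2 j
      · exact h3 j
    rw [Fin.sum_univ_four, hY0, hY1, hY2, hY3, finrank_eq_finrank_map_add_finrank_inf_ker W (ρ 3),
      finrank_eq_finrank_map_add_finrank_inf_ker V₂ (ρ 2),
      finrank_eq_finrank_map_add_finrank_inf_ker V₁ (ρ 1),
      finrank_eq_finrank_map_add_finrank_inf_ker V₀ (ρ 0), hbot, finrank_bot]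
    ring
  -- trilinear vanishing on the flag, sorted triples (polarisation of the cubics)
  have h012 : ∀ u ∈ Y 0, ∀ v ∈ Y 1, ∀ w ∈ Y 2, ∀ c, T c u v w = 0 := by
    intro u hu v hv w hw c
    rw [hY0, Submodule.mem_map] at hu
    rw [hY1, Submodule.mem_map] at hv
    rw [hY2, Submodule.mem_map] at hw
    obtain ⟨x, hx, rfl⟩ := hu
    obtain ⟨x', hx', rfl⟩ := hv
    obtain ⟨x'', hx'', rfl⟩ := hw
    obtain ⟨hxW, hx1, hx2, hx3⟩ := memV₀ x hx
    obtain ⟨hx'W, hx'2, hx'3⟩ := memV₁ x' hx'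
    obtain ⟨hx''W, hx''3⟩ := memV₂ x'' hx''
    have a := hF (x + x' + x'') (W.add_mem (W.add_mem hxW hx'W) hx''W) 3 c
    have b := hF (x + x'') (W.add_mem hxW hx''W) 3 c
    have d := hF (x' + x'') (W.add_mem hx'W hx''W) 3 c
    have g := hF x'' hx''W 3 c
    simp only [T, hρ, e30, e31, e32, Pi.add_apply, hx1, hx2, hx'2, zero_add] at a b d g ⊢
    linear_combination a - b - d + g
  have h013 : ∀ u ∈ Y 0, ∀ v ∈ Y 1, ∀ w ∈ Y 3, ∀ c, T c u v w = 0 := by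
    intro u hu v hv w hw c
    rw [hY0, Submodule.mem_map] at hu
    rw [hY1, Submodule.mem_map] at hv
    rw [hY3, Submodule.mem_map] at hw
    obtain ⟨x, hx, rfl⟩ := hu
    obtain ⟨x', hx', rfl⟩ := hv
    obtain ⟨x'', hx''W, rfl⟩ := hw
    obtain ⟨hxW, hx1, hx2, hx3⟩ := memV₀ x hx
    obtain ⟨hx'W, hx'2, hx'3⟩ := memV₁ x' hx'
    have a := hF (x + x' + x'') (W.add_mem (W.add_mem hxW hx'W) hx''W) 2 c
    have b := hF (x + x'') (W.add_mem hxW hx''W) 2 c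
    have d := hF (x' + x'') (W.add_mem hx'W hx''W) 2 c
    have g := hF x'' hx''W 2 c
    simp only [T, hρ, e20, e21, e22, Pi.add_apply, hx1, hx3, hx'3, zero_add] at a b d g ⊢
    linear_combination a - b - d + g
  have h023 : ∀ u ∈ Y 0, ∀ v ∈ Y 2, ∀ w ∈ Y 3, ∀ c, T c u v w = 0 := by
    intro u hu v hv w hw c
    rw [hY0, Submodule.mem_map] at hu
    rw [hY2, Submodule.mem_map] at hv
    rw [hY3, Submodule.mem_map] at hw
    obtain ⟨x, hx, rfl⟩ := hu
    obtain ⟨x', hx', rfl⟩ := hv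
    obtain ⟨x'', hx''W, rfl⟩ := hw
    obtain ⟨hxW, hx1, hx2, hx3⟩ := memV₀ x hx
    obtain ⟨hx'W, hx'3⟩ := memV₂ x' hx'
    have a := hF (x + x' + x'') (W.add_mem (W.add_mem hxW hx'W) hx''W) 1 c
    have b := hF (x + x'') (W.add_mem hxW hx''W) 1 c
    have d := hF (x' + x'') (W.add_mem hx'W hx''W) 1 c
    have g := hF x'' hx''W 1 c
    simp only [T, hρ, e10, e11, e12, Pi.add_apply, hx2, hx3, hx'3, zero_add] at a b d g ⊢
    linear_combination a - b - d + g
  have h123 : ∀ u ∈ Y 1, ∀ v ∈ Y 2, ∀ w ∈ Y 3, ∀ c, T c u v w = 0 := by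
    intro u hu v hv w hw c
    rw [hY1, Submodule.mem_map] at hu
    rw [hY2, Submodule.mem_map] at hv
    rw [hY3, Submodule.mem_map] at hw
    obtain ⟨x, hx, rfl⟩ := hu
    obtain ⟨x', hx', rfl⟩ := hv
    obtain ⟨x'', hx''W, rfl⟩ := hw
    obtain ⟨hxW, hx2, hx3⟩ := memV₁ x hx
    obtain ⟨hx'W, hx'3⟩ := memV₂ x' hx'
    have a := hF (x + x' + x'') (W.add_mem (W.add_mem hxW hx'W) hx''W) 0 c
    have b := hF (x + x'') (W.add_mem hxW hx''W) 0 c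
    have d := hF (x' + x'') (W.add_mem hx'W hx''W) 0 c
    have g := hF x'' hx''W 0 c
    simp only [T, hρ, e00, e01, e02, Pi.add_apply, hx2, hx3, hx'3, zero_add] at a b d g ⊢
    linear_combination a - b - d + g
  -- all ordered triples of distinct indices
  have hP : ∀ p q r : Fin 4, p ≠ q → p ≠ r → q ≠ r →
      ∀ u ∈ Y p, ∀ v ∈ Y q, ∀ w ∈ Y r, ∀ c, T c u v w = 0 := by
    intro p q r hpq hpr hqr u hu v hv w hw c
    -- the 64 value patterns of `(p, q, r)`; the 40 degenerate ones contradict distinctness, the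
    -- 24 orderings of the four 3-subsets follow from the sorted cases by the symmetry of `T`
    rcases hcases p with rfl | rfl | rfl | rfl <;> rcases hcases q with rfl | rfl | rfl | rfl <;>
      rcases hcases r with rfl | rfl | rfl | rfl <;>
      (try first | exact absurd rfl hpq | exact absurd rfl hpr | exact absurd rfl hqr)
    · exact h012 u hu v hv w hw c
    · exact h013 u hu v hv w hw c
    · exact hI2 c u v w (h012 u hu w hw v hv c)
    · exact h023 u hu v hv w hw c
    · exact hI2 c u v w (h013 u hu w hw v hv c)
    · exact hI2 c u v w (h023 u hu w hw v hv c)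
    · exact hI3 c u v w (h012 v hv u hu w hw c)
    · exact hI3 c u v w (h013 v hv u hu w hw c)
    · exact hI4 c u v w (h012 w hw u hu v hv c)
    · exact h123 u hu v hv w hw c
    · exact hI4 c u v w (h013 w hw u hu v hv c)
    · exact hI2 c u v w (h123 u hu w hw v hv c)
    · exact hI5 c u v w (h012 v hv w hw u hu c)
    · exact hI3 c u v w (h023 v hv u hu w hw c)
    · exact hI6 c u v w (h012 w hw v hv u hu c)
    · exact hI3 c u v w (h123 v hv u hu w hw c)
    · exact hI4 c u v w (h023 w hw u hu v hv c)
    · exact hI4 c u v w (h123 w hw u hu v hv c)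
    · exact hI5 c u v w (h013 v hv w hw u hu c)
    · exact hI5 c u v w (h023 v hv w hw u hu c)
    · exact hI6 c u v w (h013 w hw v hv u hu c)
    · exact hI5 c u v w (h123 v hv w hw u hu c)
    · exact hI6 c u v w (h023 w hw v hv u hu c)
    · exact hI6 c u v w (h123 w hw v hv u hu c)
  -- KEY STEP: `w_{c₀} ≠ 0`, `dim Y ≥ 3`, `T(Y, Y', w) = 0` force `dim Y' ≤ 1`
  have hPL'' : ∀ (Y₁' Y₂' : Submodule K (Fin 4 → K)) (y'' : Fin 4 → K) (c₀ : Fin 4),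
      y'' c₀ ≠ 0 → 3 ≤ finrank K Y₁' → (∀ y ∈ Y₁', ∀ y' ∈ Y₂', ∀ c, T c y y' y'' = 0) →
      finrank K Y₂' ≤ 1 := by
    intro Y₁' Y₂' y'' c₀ hc₀ hY h
    refine finrank_le_one_of_pairings Y₂' y'' hc₀ fun y' hy' j hj => ?_
    -- a nonzero `y ∈ Y₁'` vanishing at the coordinates `c₀` and `j`
    let f : Y₁' →ₗ[K] K × K := ((LinearMap.proj c₀).prod (LinearMap.proj j)).comp Y₁'.subtype
    have hker : LinearMap.ker f ≠ ⊥ := LinearMap.ker_ne_bot_of_finrank_lt (by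
      rw [finrank_prod, Module.finrank_self]; omega)
    obtain ⟨yY, hyker, hy0⟩ := Submodule.exists_mem_ne_zero_of_ne_bot hker
    have hfy : f yY = 0 := LinearMap.mem_ker.1 hyker
    have hyY : (yY : Fin 4 → K) ∈ Y₁' := yY.2
    have hyc₀ : (yY : Fin 4 → K) c₀ = 0 := congr_arg Prod.fst hfy
    have hyj : (yY : Fin 4 → K) j = 0 := congr_arg Prod.snd hfy
    have hyne : (yY : Fin 4 → K) ≠ 0 := fun h0 => hy0 (Subtype.ext h0)
    set y : Fin 4 → K := (yY : Fin 4 → K) with hydef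
    -- the pairing, multiplied by any coordinate of `y`, vanishes
    have hprod : ∀ i, y i * (y' c₀ * y'' j + y' j * y'' c₀) = 0 := by
      have hpairs : ∀ a b : Fin 4, b ≠ a →
          (a = 0 ∧ b = 1) ∨ (a = 0 ∧ b = 2) ∨ (a = 0 ∧ b = 3) ∨ (a = 1 ∧ b = 0) ∨
          (a = 1 ∧ b = 2) ∨ (a = 1 ∧ b = 3) ∨ (a = 2 ∧ b = 0) ∨ (a = 2 ∧ b = 1) ∨
          (a = 2 ∧ b = 3) ∨ (a = 3 ∧ b = 0) ∨ (a = 3 ∧ b = 1) ∨ (a = 3 ∧ b = 2) := by decide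
      have t0 := h y hyY y' hy' 0
      have t1 := h y hyY y' hy' 1
      have t2 := h y hyY y' hy' 2
      have t3 := h y hyY y' hy' 3
      simp only [T, e00, e01, e02, e10, e11, e12, e20, e21, e22, e30, e31, e32] at t0 t1 t2 t3
      rcases hpairs c₀ j hj with ⟨rfl, rfl⟩ | ⟨rfl, rfl⟩ | ⟨rfl, rfl⟩ | ⟨rfl, rfl⟩ | ⟨rfl, rfl⟩ |
        ⟨rfl, rfl⟩ | ⟨rfl, rfl⟩ | ⟨rfl, rfl⟩ | ⟨rfl, rfl⟩ | ⟨rfl, rfl⟩ | ⟨rfl, rfl⟩ | ⟨rfl, rfl⟩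
      all_goals
        simp only [hyc₀, hyj, zero_mul, zero_add, add_zero] at t0 t1 t2 t3
        intro i
        rcases hcases i with rfl | rfl | rfl | rfl <;>
          first
          | (rw [hyc₀]; ring) | (rw [hyj]; ring)
          | linear_combination t0 | linear_combination t1
          | linear_combination t2 | linear_combination t3
    obtain ⟨i, hi⟩ : ∃ i, y i ≠ 0 := Function.ne_iff.1 hyne
    exact (mul_eq_zero.1 (hprod i)).resolve_left hi
  -- the count
  have hle : ∀ i, finrank K (Y i) ≤ 4 := fun i =>
    ((Y i).finrank_le).trans (by rw [finrank_fintype_fun_eq_card, Fintype.card_fin])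
  have hPLn : ∀ p q r, p ≠ q → p ≠ r → q ≠ r → 1 ≤ finrank K (Y r) → 3 ≤ finrank K (Y p) →
      finrank K (Y q) ≤ 1 := by
    intro p q r hpq hpr hqr hr hp
    have hne : Y r ≠ ⊥ := fun h => by rw [h, finrank_bot] at hr; exact absurd hr (by decide)
    obtain ⟨w, hw, hw0⟩ := Submodule.exists_mem_ne_zero_of_ne_bot hne
    obtain ⟨c₀, hc₀⟩ : ∃ c₀, w c₀ ≠ 0 := Function.ne_iff.1 hw0
    exact hPL'' (Y p) (Y q) w c₀ hc₀ hp fun u hu v hv c => hP p q r hpq hpr hqr u hu v hv w hw c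
  rw [hdim]
  exact sum_le_eight_of_triples (fun i => finrank K (Y i)) hle hPLn

end AlperBogartVelasco

end Literature.Computability.AlgebraicComplexity
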